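import Summits.BirchSwinnertonDyer.BirchSwinnertonDyer.Theorems.SignedLowerHalvesSmallImageLowerHalfBothSignsRttD2SeqSemilocExact
import Summits.BirchSwinnertonDyer.BirchSwinnertonDyer.Theorems.SignedLowerHalvesSmallImageLowerHalfBothSignsRttJunctionShaLocCountOffP
import Summits.BirchSwinnertonDyer.BirchSwinnertonDyer.Theorems.SignedLowerHalvesSmallImageLowerHalfBothSignsRttD2SeqJ3HS2
import HarnessLib

/-!
# Route `SignedLowerHalves`, crux L `SmallImageLowerHalfBothSigns` (stmt-BirchSwinnertonDyer-23599), line `rtt_w3` v30 — stub S3β″ (`stub_junctionPT_ns`), input N5-(i) IN THE FRAME: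
# T5's `hfin ∧ htors` for `Π_{w∈S₀K} 𝐇¹_{Iw,w}` over the restricted cyclotomic tower of the quadratic field, from `θ′|_{N_P} = 1`, «`P` contains the places above `p`» and `p ∉ w` on `S₀K`

WIDTH seat `bsd-line-slh-p3-w3` g26 under LEAD `cruxlead-stmt-BirchSwinnertonDyer-23599` g14 (cell `bsd-ssimc`); helper `--supports stmt-BirchSwinnertonDyer-23599`. THEOREMS ONLY.
HONEST FRAMING: plumbing of `moduleFinite_and_isTorsion_pi_semiloc` (p818012) into the frame's vocabulary: `hμN` from g24's `mu_apply_eq_self_of_mem_ramificationSubgroup` (all places above `p`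
lie in `P`), the finite decomposition `hdec` at every `w ∤ p` from honda g28's `exists_toAdd_restrict_resGalOfEmb_ne_zero` (restricted cyclotomic tower `κ_ℚ|_K`, `K` quadratic) and
`PadicInt.unitCoeff_spec`. Remaining displayed input: `hθN : θ′|_{N_P} = 1` (the same input as S2's `exact_junctionMap_comp_subtype_cofree_lam_of_lamPerfect`). Nothing about S3β″, crux L
or BSD is proved; all remain OPEN and are proved for NO curve.
References: [Washington1997] §13.1–§13.2; [NeukirchSchmidtWingberg2008] (8.6.2)–(8.6.3); [SerreAbelianLadic1968] Ch. I §1.2; [PerrinRiou1994Invent] §1.3.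
-/

set_option autoImplicit false
set_option linter.dupNamespace false -- D-0017: single-problem summit, the namespace repeats the problem name by design
noncomputable section

open scoped Classical
open NumberField IsDedekindDomain Field

namespace Summit.BirchSwinnertonDyer.BirchSwinnertonDyer.Theorems.SmallImageRttD2Seq

open Literature.NumberTheory.EllipticCurves Literature.NumberTheory.GaloisRepresentations Literature.NumberTheory.GaloisRepresentations.DiscreteGaloisModule
  Literature.NumberTheory.ComplexMultiplication.EllipticUnits.JohnsonLeungKings2011
  Summit.BirchSwinnertonDyer.BirchSwinnertonDyer.Theorems.SmallImageRttD2J1 Summit.BirchSwinnertonDyer.BirchSwinnertonDyer.Theorems.SmallImageRttJunctionSha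

variable {p : ℕ} [Fact p.Prime] (hp : p ≠ 2) {κ : ZpExtension ℚ p} {K : Type} [Field K] [NumberField K] (hK2 : Module.finrank ℚ K = 2)
  (S : Set (PadicAlgCl p)) [FiniteDimensional ℚ_[p] (padicCoeffField S)]

/-- **Finite decomposition in the `(e, u₀)`-currency**: at every `w ∤ p` the restricted cyclotomic tower of the quadratic field `K` has a local element `σ ∈ Γ_{K_w}` with
`κ_K(res σ) = p^e · u₀` (honda g28 `exists_toAdd_restrict_resGalOfEmb_ne_zero` + `PadicInt.unitCoeff_spec`). [cite: Washington1997, §13.1] [cite: NeukirchANT1999, II §9 Prop. (9.6)] -/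
theorem exists_toAdd_restrict_resGalOfEmb_eq_pow_mul (hκ : κ.IsCyclotomic) {γ : absoluteGaloisGroup ℚ} (hγ : κ.IsTopGenerator γ) (hcv : IsCyclotomicVariable p γ)
    {w : HeightOneSpectrum (𝓞 K)} (hwp : ((p : ℕ) : 𝓞 K) ∉ w.asIdeal) :
    ∃ (σ : absoluteGaloisGroup (w.adicCompletion K)) (e : ℕ) (u₀ : ℤ_[p]ˣ),
      ((κ.restrictOfFinrankEqTwo hp K hK2) (resGalOfEmb (closureEmb (K := K) (w.adicCompletion K)) σ)).toAdd = (p : ℤ_[p]) ^ e * u₀ := by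
  classical
  haveI : Finite (𝓞 K ⧸ w.asIdeal) := Ideal.finiteQuotientOfFreeOfNeBot w.asIdeal w.ne_bot
  letI : Fintype (𝓞 K ⧸ w.asIdeal) := Fintype.ofFinite _
  letI : Field (𝓞 K ⧸ w.asIdeal) := Ideal.Quotient.field _
  obtain ⟨n, hℓ, -⟩ := FiniteField.card (𝓞 K ⧸ w.asIdeal) (ringChar (𝓞 K ⧸ w.asIdeal))
  have hℓw : ((ringChar (𝓞 K ⧸ w.asIdeal) : ℕ) : 𝓞 K) ∈ w.asIdeal := by
    rw [← Ideal.Quotient.eq_zero_iff_mem, map_natCast]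
    exact ringChar.Nat.cast_ringChar
  have hℓp : ringChar (𝓞 K ⧸ w.asIdeal) ≠ p := fun h ↦ hwp (h ▸ hℓw)
  obtain ⟨σ, hσ0⟩ := exists_toAdd_restrict_resGalOfEmb_ne_zero hp hK2 hκ hγ hcv hℓ hℓp hℓw
  exact ⟨σ, _, PadicInt.unitCoeff hσ0, by rw [mul_comm]; exact PadicInt.unitCoeff_spec hσ0⟩

/-- ★★★ **T5's `hfin ∧ htors` IN THE FRAME**: for the restricted cyclotomic tower `κ_ℚ|_K` of the quadratic field `K`, a character `θ′` trivial on `N_P`, a set `P` containing every place above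
`p`, and a finite set `S₀` of places with `p ∉ w`, the product `Π_{w∈S₀} 𝐇¹_{Iw,w}` of the CONSTRUCTED semilocal Iwasawa data is finitely generated AND torsion over `Λ`.
[cite: Washington1997, §13.2 Lemma 13.16] [cite: NeukirchSchmidtWingberg2008, (8.6.2)–(8.6.3)] [cite: Rubin2000, App. B.3] [cite: PerrinRiou1994Invent, §1.3] -/
theorem moduleFinite_and_isTorsion_pi_semiloc_of_cyclotomic (hκ : κ.IsCyclotomic) {γ : absoluteGaloisGroup ℚ} (hγ : κ.IsTopGenerator γ) (hcv : IsCyclotomicVariable p γ)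
    (γK : absoluteGaloisGroup K) (θ' : absoluteGaloisGroup K →ₜ* (padicCoeffIntegers S)ˣ) (P : Set (HeightOneSpectrum (𝓞 K)))
    (hθN : ∀ g ∈ ramificationSubgroup K P, θ' g = 1) (hPp : ∀ w : HeightOneSpectrum (𝓞 K), w ∉ P → ((p : ℕ) : 𝓞 K) ∉ w.asIdeal)
    (S₀ : Set (HeightOneSpectrum (𝓞 K))) (hS₀ : S₀.Finite) (hS₀p : ∀ w ∈ S₀, ((p : ℕ) : 𝓞 K) ∉ w.asIdeal) :
    letI : ∀ w : HeightOneSpectrum (𝓞 K), Module (IwasawaAlgebra p) (semilocIwasawaCohomologyDataO S (κ.restrictOfFinrankEqTwo hp K hK2) γK θ' P w 1).H :=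
      fun w ↦ (semilocIwasawaCohomologyDataO S (κ.restrictOfFinrankEqTwo hp K hK2) γK θ' P w 1).moduleIwasawa
    Module.Finite (IwasawaAlgebra p) (∀ w : S₀, (semilocIwasawaCohomologyDataO S (κ.restrictOfFinrankEqTwo hp K hK2) γK θ' P w 1).H) ∧
      Module.IsTorsion (IwasawaAlgebra p) (∀ w : S₀, (semilocIwasawaCohomologyDataO S (κ.restrictOfFinrankEqTwo hp K hK2) γK θ' P w 1).H) :=
  moduleFinite_and_isTorsion_pi_semiloc S (κ.restrictOfFinrankEqTwo hp K hK2) θ' P γK hθN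
    (fun m _ hg ζ ↦ mu_apply_eq_self_of_mem_ramificationSubgroup P hPp m hg ζ) S₀ hS₀ hS₀p
    (fun w hw ↦ exists_toAdd_restrict_resGalOfEmb_eq_pow_mul hp hK2 hκ hγ hcv (hS₀p w hw))

end Summit.BirchSwinnertonDyer.BirchSwinnertonDyer.Theorems.SmallImageRttD2Seq

end
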